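import Summits.AtomisticToContinuum.HydrodynamicLimit.Theorems.AntiMazurCoboundariesInfluenceLocalityAnchoredCoveringLineage
import Literature.Analysis.FluidPDE.LocalForecastCorrector

/-!
# The deterministic light cone of `stub_influenceLocality` (`TorusInfluenceLocality`), line
# `entropy-ball-invariant-states` (crux `CellForecastPressureDecay`, stmt-AtomisticToContinuum-13915)

Helper file (`--supports stmt-AtomisticToContinuum-13915`, registered sub-goal `stub_influenceLocalityCovering`)
for the registered stub `stub_influenceLocality : TorusInfluenceLocality`: the DETERMINISTIC half of finite speed of
influence, at general diameter `ε`, horizon `L`, range `ρ`, halo `ρ'` and caps `U ≤ W` (the stub uses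
`ε = σ/Λ`, `L = s/Λ`, `ρ = R/Λ` for every `n ≤ 2Λ³`, so nothing may be tied to the `N + 1` / `hsDiameter` frame
of the sibling crux 13916). Everything is imported from the sibling line `true-anchored-infection` of crux 13916,
whose infection theory (`TrueAnchoredInfection.exists_carrier`: every infection is a contact with an outsider or
with a strictly earlier infected carrier, in the true or in the forecast world) and anchored lineages
(`TrueAnchoredInfection.CoveringSetting.exists_lineage`) are stated for any torus `𝕋^d`, any `ε`, `N`, `k`.

* `exists_rawChain_of_bad` — **bad ∧ capped ⇒ anchored chain.** On the good set (`z ∈ Φ.good`, the range-`ρ`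
  cluster `S` of `i` restricts to a good datum of `Ψ |S|`), if particle `i` is BAD on `[0, L]`
  (`∃ t ∈ [0, L], Φ_t z i ≠ localClusterState Ψ ρ t z i`), every TRUE particle has speed `≤ U` whenever it is
  within `ρ'` of `x_i(0)` during `[0, L]`, every particle of the FORECAST world of `i` has speed `≤ W` on `[0, L]`,
  `ρ + U L < ρ'` and `(K + 2) ε + (U + W) L ≤ ρ`, then `K + 1` DISTINCT true particles `j 0, …, j K = i` and times
  `0 < τ 0 < ⋯ < τ K ≤ L` exist with the causal step bound
  `dist(x_{j(m+1)}(τ (m+1)), x_{j m}(τ m)) ≤ ε + W (τ (m+1) − τ m)` — one diameter per link plus `W`-causal motion: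
  the first-infection lineage of `i` read backwards (its root, an outsider initially farther than `ρ`, cannot be
  reached by `K` such links).
* `card_lt_of_bad` — hence at least `K + 1` particles of the range cluster are involved: **a range cluster of at
  most `K` members with these caps forecasts `i` exactly on `[0, L]`** (`forecast_eq_of_card_le`); in particular
  (`K = 0` is excluded by `i ∈ S`, `K = 1`): a LONE capped particle whose halo sees no `U`-fast particle is forecast
  exactly as long as `3ε + (U + W) L ≤ ρ`.

The probabilistic half of the stub (the Maxwellian cost of violating the caps, and the `torusGibbs`-pressure of the
endpoints of such chains, uniformly in the density `n/Λ³ ≤ 2`) is the open LD core; see the line's worker audit.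
-/

namespace Summit.AtomisticToContinuum.HydrodynamicLimit.Theorems.EntropyBall.InfluenceLocality

open Set Function
open Literature.Analysis Literature.Analysis.FluidPDE
open Summit.AtomisticToContinuum.HydrodynamicLimit.Theorems.TrueAnchoredInfection

noncomputable section

variable {d : Type*} [Fintype d] {n : ℕ} {ε L U W ρ ρ' : ℝ}

/-- **Bad ∧ capped ⇒ anchored raw chain of `K` links** (the first-infection lineage of `i`, read backwards; see the
module docstring). General torus `𝕋^d`, diameter `ε`, horizon `L`, range `ρ`, halo `ρ'`, caps `U ≤ W`. -/
theorem exists_rawChain_of_bad {K : ℕ} (Φ : HardSphereFlow (Torus.geometry d) ε n)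
    (Ψ : (k : ℕ) → HardSphereFlow (Torus.geometry d) ε k) (hε : 0 < ε) (hU : 0 ≤ U) (hUW : U ≤ W)
    (hmargin : ρ + U * L < ρ') (hspan : ((K : ℝ) + 2) * ε + (U + W) * L ≤ ρ)
    {z : Config n d (UnitAddTorus d)} (hz : z ∈ Φ.good) {i : Fin n}
    (hy : Config.restrictTo (rangeCluster (Torus.geometry d) ρ z i) z ∈
      (Ψ (rangeCluster (Torus.geometry d) ρ z i).card).good)
    (hbad : ∃ t ∈ Icc 0 L, Φ.flow t z i ≠ localClusterState Ψ ρ t z i)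
    (hcapΓ : ∀ c, ∀ t ∈ Icc 0 L, Torus.euclidDist (Φ.flow t z c).1 (z i).1 < ρ' → ‖(Φ.flow t z c).2‖ ≤ U)
    (hcapF : ∀ m, ∀ t ∈ Icc 0 L, ‖((Ψ (rangeCluster (Torus.geometry d) ρ z i).card).flow t
      (Config.restrictTo (rangeCluster (Torus.geometry d) ρ z i) z) m).2‖ ≤ W) :
    ∃ (j : Fin (K + 1) → Fin n) (τ : Fin (K + 1) → ℝ), Injective j ∧ j (Fin.last K) = i ∧
      StrictMono τ ∧ (∀ s, 0 < τ s ∧ τ s ≤ L) ∧ (∀ s, j s ∈ rangeCluster (Torus.geometry d) ρ z i) ∧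
      ∀ m : Fin K, Torus.euclidDist (Φ.flow (τ m.succ) z (j m.succ)).1
          (Φ.flow (τ m.castSucc) z (j m.castSucc)).1 ≤ ε + W * (τ m.succ - τ m.castSucc) := by
  -- adapted from TrueAnchoredInfection.exists_rawChain_of_good (crux 13916), caps given at real times
  set S := rangeCluster (Torus.geometry d) ρ z i with hSdef
  set Γ : ℝ → Config n d (UnitAddTorus d) := fun t => Φ.flow t z with hΓdef
  set F : ℝ → Config S.card d (UnitAddTorus d) := fun t => (Ψ S.card).flow t (Config.restrictTo S z)
    with hFdef
  set e : Fin S.card → Fin n := fun m => S.orderEmbOfFin rfl m with hedef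
  set m₀ : Fin S.card := clusterIndex S i (self_mem_rangeCluster (Torus.geometry d) ρ z i) with hm₀def
  have hem₀ : e m₀ = i := orderEmbOfFin_clusterIndex S i _
  have hΓ : IsHardSphereTrajectory (Torus.geometry d) ε n Γ := Φ.isTrajectory z hz
  have hF : IsHardSphereTrajectory (Torus.geometry d) ε S.card F := (Ψ S.card).isTrajectory _ hy
  have hΓ0 : Γ 0 = z := Φ.flow_zero z hz
  have hF0 : F 0 = Config.restrictTo S z := (Ψ S.card).flow_zero _ hy
  have h0 : ∀ m, F 0 m = Γ 0 (e m) := fun m => by rw [hF0, hΓ0]; rfl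
  have he : Injective e := (S.orderEmbOfFin rfl).injective
  have heS : ∀ m, e m ∈ S := fun m => S.orderEmbOfFin_mem rfl m
  -- `0 ≤ L` (badness happens at a time of `[0, L]`) and `0 ≤ ρ`
  obtain ⟨t₀, ht₀, -⟩ := id hbad
  have hL0 : 0 ≤ L := ht₀.1.trans ht₀.2
  have hρ0 : 0 ≤ ρ := by nlinarith [hspan, hε, hU, hUW, hL0]
  have hcapΓ' : ∀ c, ∀ t ∈ Icc 0 L, Torus.euclidDist (Γ t c).1 (Γ 0 (e m₀)).1 < ρ' → ‖(Γ t c).2‖ ≤ U := by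
    intro c t ht hin
    rw [hem₀, hΓ0] at hin
    exact hcapΓ c t ht hin
  have hmem : ∀ m, Torus.euclidDist (Γ 0 (e m)).1 (Γ 0 (e m₀)).1 ≤ ρ := by
    intro m
    rw [hem₀, hΓ0]
    rcases mem_rangeCluster_torus.1 (heS m) with h | h
    · rw [h, Torus.euclidDist_self]; exact hρ0
    · rwa [Torus.euclidDist_comm]
  have hout : ∀ c, c ∉ Set.range e → ρ < Torus.euclidDist (Γ 0 c).1 (Γ 0 (e m₀)).1 := by
    intro c hc
    rw [hem₀, hΓ0]
    have h : c ∉ S := fun hcS => hc ⟨clusterIndex S c hcS, orderEmbOfFin_clusterIndex S c hcS⟩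
    rw [hSdef, mem_rangeCluster_torus, not_or, not_le] at h
    rw [Torus.euclidDist_comm]
    exact h.2
  -- badness of `i` = infection of `m₀`
  have hloc : ∀ t, localClusterState Ψ ρ t z i = F t m₀ := fun t => clusterStateIn_of_mem_good Ψ _ t hy
  have hbad' : ∃ t ∈ Icc 0 L, Γ t (e m₀) ≠ F t m₀ := by
    obtain ⟨t, ht, hne⟩ := hbad
    refine ⟨t, ht, ?_⟩
    rw [hem₀, ← hloc t]
    exact hne
  -- the lineage of `K` links hanging from `m₀`
  have hlin : ∀ n' ≤ K, ∃ a : ℕ → Fin S.card, a ∈ lineages ε W Γ F e m₀ n' :=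
    CoveringSetting.exists_lineage
      { ε := ε, L := L, U := U, W := W, ρ := ρ, ρ' := ρ', Γ := Γ, F := F, e := e, m₀ := m₀, hΓ := hΓ,
        hF := hF, h0 := h0, he := he, hε := hε, hU := hU, hUW := hUW, hmargin := hmargin, hmem := hmem,
        hout := hout, hcapΓ := hcapΓ', hcapF := hcapF } hspan hbad'
  obtain ⟨a, ha⟩ := hlin K le_rfl
  have hL₀ : infTime Γ F e m₀ ≤ L := infTime_le_of_bad hbad'
  -- reversed: chain members `a (K - s)` with increasing infection times
  refine ⟨fun s => e (a (K - s)), fun s => infTime Γ F e (a (K - s)), ?_, ?_, ?_, fun s => ⟨?_, ?_⟩,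
    fun s => heS _, fun m => ?_⟩
  · intro s s' hss
    have h2 : K - (s : ℕ) = K - s' := Lineage.injOn ha (Nat.sub_le _ _) (Nat.sub_le _ _) (he hss)
    have hs := s.2
    have hs' := s'.2
    exact Fin.ext (by omega)
  · show e (a (K - K)) = i
    rw [Nat.sub_self, ha.1, hem₀]
  · intro s s' hss
    have hss' : (s : ℕ) < s' := Fin.lt_def.1 hss
    have hs' := s'.2
    exact Lineage.infTime_lt ha (by omega) (Nat.sub_le _ _)
  · exact infTime_pos hΓ hF h0 (ha.2.1 (K - s) (Nat.sub_le _ _))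
  · exact (Lineage.infTime_le_head ha (Nat.sub_le _ _)).trans hL₀
  · have hm : (m : ℕ) < K := m.2
    have h := (ha.2.2 (K - (m + 1)) (by omega)).2
    have hidx : K - (m + 1) + 1 = K - m := by omega
    rw [hidx] at h
    simpa only [Fin.val_succ, Fin.val_castSucc] using h

/-- **A capped bad particle involves more than `K` cluster members**: under the hypotheses of
`exists_rawChain_of_bad` the range cluster of `i` has at least `K + 1` members (the chain particles are distinct
members). -/
theorem card_lt_of_bad {K : ℕ} (Φ : HardSphereFlow (Torus.geometry d) ε n)
    (Ψ : (k : ℕ) → HardSphereFlow (Torus.geometry d) ε k) (hε : 0 < ε) (hU : 0 ≤ U) (hUW : U ≤ W)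
    (hmargin : ρ + U * L < ρ') (hspan : ((K : ℝ) + 2) * ε + (U + W) * L ≤ ρ)
    {z : Config n d (UnitAddTorus d)} (hz : z ∈ Φ.good) {i : Fin n}
    (hy : Config.restrictTo (rangeCluster (Torus.geometry d) ρ z i) z ∈
      (Ψ (rangeCluster (Torus.geometry d) ρ z i).card).good)
    (hbad : ∃ t ∈ Icc 0 L, Φ.flow t z i ≠ localClusterState Ψ ρ t z i)
    (hcapΓ : ∀ c, ∀ t ∈ Icc 0 L, Torus.euclidDist (Φ.flow t z c).1 (z i).1 < ρ' → ‖(Φ.flow t z c).2‖ ≤ U)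
    (hcapF : ∀ m, ∀ t ∈ Icc 0 L, ‖((Ψ (rangeCluster (Torus.geometry d) ρ z i).card).flow t
      (Config.restrictTo (rangeCluster (Torus.geometry d) ρ z i) z) m).2‖ ≤ W) :
    K < (rangeCluster (Torus.geometry d) ρ z i).card := by
  obtain ⟨j, -, hj, -, -, -, hjS, -⟩ := exists_rawChain_of_bad Φ Ψ hε hU hUW hmargin hspan hz hy hbad hcapΓ hcapF
  classical
  have h : (Finset.univ.image j).card = K + 1 := by
    rw [Finset.card_image_of_injective _ hj, Finset.card_univ, Fintype.card_fin]
  have hsub : Finset.univ.image j ⊆ rangeCluster (Torus.geometry d) ρ z i := by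
    intro c hc
    obtain ⟨s, -, rfl⟩ := Finset.mem_image.1 hc
    exact hjS s
  have := Finset.card_le_card hsub
  omega

/-- **Small capped clusters forecast exactly.** On the good set, if the range-`ρ` cluster of `i` has at most `K`
members, true particles are `U`-capped in the halo `B(x_i(0), ρ')` and the forecast world of `i` is `W`-capped on
`[0, L]`, with `ρ + U L < ρ'` and `(K + 2) ε + (U + W) L ≤ ρ`, then the range-`ρ` forecast of `i` is EXACT on
`[0, L]`: `Φ_t z i = localClusterState Ψ ρ t z i`. (`K = 1`: a lone capped particle in a quiet halo flies as
forecast as long as `3ε + (U + W) L ≤ ρ`.) -/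
theorem forecast_eq_of_card_le {K : ℕ} (Φ : HardSphereFlow (Torus.geometry d) ε n)
    (Ψ : (k : ℕ) → HardSphereFlow (Torus.geometry d) ε k) (hε : 0 < ε) (hU : 0 ≤ U) (hUW : U ≤ W)
    (hmargin : ρ + U * L < ρ') (hspan : ((K : ℝ) + 2) * ε + (U + W) * L ≤ ρ)
    {z : Config n d (UnitAddTorus d)} (hz : z ∈ Φ.good) {i : Fin n}
    (hy : Config.restrictTo (rangeCluster (Torus.geometry d) ρ z i) z ∈
      (Ψ (rangeCluster (Torus.geometry d) ρ z i).card).good)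
    (hcard : (rangeCluster (Torus.geometry d) ρ z i).card ≤ K)
    (hcapΓ : ∀ c, ∀ t ∈ Icc 0 L, Torus.euclidDist (Φ.flow t z c).1 (z i).1 < ρ' → ‖(Φ.flow t z c).2‖ ≤ U)
    (hcapF : ∀ m, ∀ t ∈ Icc 0 L, ‖((Ψ (rangeCluster (Torus.geometry d) ρ z i).card).flow t
      (Config.restrictTo (rangeCluster (Torus.geometry d) ρ z i) z) m).2‖ ≤ W) :
    ∀ t ∈ Icc 0 L, Φ.flow t z i = localClusterState Ψ ρ t z i := by
  by_contra h
  push Not at h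
  obtain ⟨t, ht, hne⟩ := h
  exact (card_lt_of_bad Φ Ψ hε hU hUW hmargin hspan hz hy ⟨t, ht, hne⟩ hcapΓ hcapF).not_ge hcard

/-! ## Registered form -/

/-- **Registered helper statement `stub_influenceLocalityCovering`** (sub-goal of `stub_influenceLocality`, line
`entropy-ball-invariant-states`, crux stmt-AtomisticToContinuum-13915): on the good set, under the caps `U ≤ W`
(true particles in the halo `B(x_i(0), ρ')`, forecast world of `i`), `ρ + U L < ρ'` and `(K + 2)ε + (U + W)L ≤ ρ`,
(i) a bad particle `i` is the endpoint of an anchored raw chain of `K` links through distinct cluster members, and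
(ii) a range cluster of at most `K` members forecasts `i` exactly on `[0, L]`. -/
theorem stub_influenceLocalityCovering : ∀ {d : Type} [Fintype d] {n K : ℕ} {ε L U W ρ ρ' : ℝ} (Φ : HardSphereFlow (Torus.geometry d) ε n) (Ψ : (k : ℕ) → HardSphereFlow (Torus.geometry d) ε k), 0 < ε → 0 ≤ U → U ≤ W → ρ + U * L < ρ' → ((K : ℝ) + 2) * ε + (U + W) * L ≤ ρ → ∀ {z : Config n d (UnitAddTorus d)}, z ∈ Φ.good → ∀ {i : Fin n}, Config.restrictTo (rangeCluster (Torus.geometry d) ρ z i) z ∈ (Ψ (rangeCluster (Torus.geometry d) ρ z i).card).good → (∀ c, ∀ t ∈ Set.Icc 0 L, Torus.euclidDist (Φ.flow t z c).1 (z i).1 < ρ' → ‖(Φ.flow t z c).2‖ ≤ U) → (∀ m, ∀ t ∈ Set.Icc 0 L, ‖((Ψ (rangeCluster (Torus.geometry d) ρ z i).card).flow t (Config.restrictTo (rangeCluster (Torus.geometry d) ρ z i) z) m).2‖ ≤ W) → ((∃ t ∈ Set.Icc 0 L, Φ.flow t z i ≠ localClusterState Ψ ρ t z i) → ∃ (j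 : Fin (K + 1) → Fin n) (τ : Fin (K + 1) → ℝ), Function.Injective j ∧ j (Fin.last K) = i ∧ StrictMono τ ∧ (∀ s, 0 < τ s ∧ τ s ≤ L) ∧ (∀ s, j s ∈ rangeCluster (Torus.geometry d) ρ z i) ∧ ∀ m : Fin K, Torus.euclidDist (Φ.flow (τ m.succ) z (j m.succ)).1 (Φ.flow (τ m.castSucc) z (j m.castSucc)).1 ≤ ε + W * (τ m.succ - τ m.castSucc)) ∧ ((rangeCluster (Torus.geometry d) ρ z i).card ≤ K → ∀ t ∈ Set.Icc 0 L, Φ.flow t z i = localClusterState Ψ ρ t z i) :=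
  fun Φ Ψ hε hU hUW hmargin hspan _ hz _ hy hcapΓ hcapF =>
    ⟨fun hbad => exists_rawChain_of_bad Φ Ψ hε hU hUW hmargin hspan hz hy hbad hcapΓ hcapF,
      fun hcard => forecast_eq_of_card_le Φ Ψ hε hU hUW hmargin hspan hz hy hcard hcapΓ hcapF⟩

end

end Summit.AtomisticToContinuum.HydrodynamicLimit.Theorems.EntropyBall.InfluenceLocality
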